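import Mathlib.Analysis.InnerProductSpace.PiL2
import HarnessLib

/-!
# The outside of the double cone in a fold box retracts onto its core circle

Helper layer `helper_timelike_coneRetraction` (generic model topology) of stub
`helper_foldNF_timelike` (the untwistedness of the round `1`-handle of a genus-one simplified
broken Lefschetz fibration), line `Sketch`, crux `SblfDescent.RungOne`.

(Crux item stmt-SmoothPoincare4-18531; skeleton `Cruxes/RungOne/Lines/Sketch.lean`.)

In a fold chart `(t, x₁, x₂, x₃) ↦ (t, x₁² + x₂² - x₃²)` the higher-genus side near the round
point is the region `x₁² + x₂² > x₃²` of a small box: an interval times the outside of a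
double cone, which deformation retracts onto the core circle `t = x₃ = 0`, `x₁² + x₂² = ρ²`
(the vanishing cycle).  This file writes the deformation down (`helper_timelike_coneRetraction`):
`k_s (t, x₁, x₂, x₃) = ((1 - s) t, m_s x₁, m_s x₂, (1 - s) x₃)` with
`m_s = (1 - s) + s ρ/√(x₁² + x₂²)` (`s` clamped to `[0, 1]`), continuous where `(x₁, x₂) ≠ 0`,
the identity at `s = 0`, the radial projection onto the core circle at `s = 1`, preserving the
region `x₁² + x₂² > x₃²`, the ball `‖·‖ < δ` (for `ρ < δ`) and the slab `|t| ≤ |t₀|`.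

## References

* R. İ. Baykur, O. Saeki, *Simplifying indefinite fibrations on 4-manifolds*, arXiv:1705.11169,
  §2.1 (the fibres of the indefinite fold near the fold point). [BaykurSaeki2017]
-/

set_option linter.dupNamespace false

noncomputable section

open scoped Topology
open Set Function Filter

namespace Summit.SmoothPoincare4.SmoothPoincare4.Cruxes.RungOne.Sketch

/-- **The cone retraction of a fold box.**  For `0 < ρ < δ` there is a deformation
`k : ℝ → ℝ⁴ → ℝ⁴` (coordinates `(t, x₁, x₂, x₃) = (v₀, v₁, v₂, v₃)`), continuous on
`ℝ × {x₁² + x₂² > 0}`, with `k₀ = id`, `k₁ v = (0, ρ x₁/r, ρ x₂/r, 0)` (`r = √(x₁² + x₂²)`),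
`k_s = k₀` for `s ≤ 0`, `k_s = k₁` for `s ≥ 1`, preserving `x₁² + x₂² - x₃² > 0`,
`x₁² + x₂² > 0`, the ball `‖v‖ < δ` and not increasing `|t|`. [cite: BaykurSaeki2017, §2.1] -/
theorem helper_timelike_coneRetraction : ∀ (ρ δ : ℝ), 0 < ρ → ρ < δ → ∃ k : ℝ → EuclideanSpace ℝ (Fin 4) → EuclideanSpace ℝ (Fin 4), ContinuousOn (fun x : ℝ × EuclideanSpace ℝ (Fin 4) => k x.1 x.2) (Set.univ ×ˢ {v : EuclideanSpace ℝ (Fin 4) | 0 < v 1 ^ 2 + v 2 ^ 2}) ∧ (∀ v, k 0 v = v) ∧ (∀ (s : ℝ) (v : EuclideanSpace ℝ (Fin 4)), s ≤ 0 → k s v = v) ∧ (∀ (s : ℝ) (v : EuclideanSpace ℝ (Fin 4)), 1 ≤ s → k s v = k 1 v) ∧ (∀ v : EuclideanSpace ℝ (Fin 4), 0 < v 1 ^ 2 + v 2 ^ 2 → k 1 v 0 = 0 ∧ k 1 v 1 = ρ * v 1 / Real.sqrt (v 1 ^ 2 + v 2 ^ 2) ∧ k 1 v 2 = ρ * v 2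 / Real.sqrt (v 1 ^ 2 + v 2 ^ 2) ∧ k 1 v 3 = 0) ∧ (∀ (s : ℝ) (v : EuclideanSpace ℝ (Fin 4)), 0 < v 1 ^ 2 + v 2 ^ 2 - v 3 ^ 2 → 0 < k s v 1 ^ 2 + k s v 2 ^ 2 - k s v 3 ^ 2) ∧ (∀ (s : ℝ) (v : EuclideanSpace ℝ (Fin 4)), 0 < v 1 ^ 2 + v 2 ^ 2 → 0 < k s v 1 ^ 2 + k s v 2 ^ 2) ∧ (∀ (s : ℝ) (v : EuclideanSpace ℝ (Fin 4)), 0 < v 1 ^ 2 + v 2 ^ 2 → ‖v‖ < δ → ‖k s v‖ < δ) ∧ (∀ (s : ℝ) (v : EuclideanSpace ℝ (Fin 4)), |k s v 0| ≤ |v 0|) := by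
  intro ρ δ hρ hρδ
  -- the clamp and the stretch factor
  set σ : ℝ → ℝ := fun s => max 0 (min 1 s) with hσ
  have hσc : Continuous σ := continuous_const.max (continuous_const.min continuous_id)
  have hσ01 : ∀ s, 0 ≤ σ s ∧ σ s ≤ 1 := fun s =>
    ⟨le_max_left _ _, max_le zero_le_one (min_le_left _ _)⟩
  have hσ0 : ∀ s, s ≤ 0 → σ s = 0 := fun s hs => by
    simp [hσ, max_eq_left ((min_le_right 1 s).trans hs)]
  have hσ1 : ∀ s, 1 ≤ s → σ s = 1 := fun s hs => by simp [hσ, min_eq_left hs]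
  set nr : EuclideanSpace ℝ (Fin 4) → ℝ := fun v => Real.sqrt (v 1 ^ 2 + v 2 ^ 2) with hnr
  set m : ℝ → EuclideanSpace ℝ (Fin 4) → ℝ := fun s v => (1 - σ s) + σ s * ρ / nr v with hm
  set k : ℝ → EuclideanSpace ℝ (Fin 4) → EuclideanSpace ℝ (Fin 4) := fun s v =>
    WithLp.toLp 2 ![(1 - σ s) * v 0, m s v * v 1, m s v * v 2, (1 - σ s) * v 3] with hk
  have hk0 : ∀ s v, k s v 0 = (1 - σ s) * v 0 := fun s v => by simp [hk]
  have hk1 : ∀ s v, k s v 1 = m s v * v 1 := fun s v => by simp [hk]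
  have hk2 : ∀ s v, k s v 2 = m s v * v 2 := fun s v => by simp [hk]
  have hk3 : ∀ s v, k s v 3 = (1 - σ s) * v 3 := fun s v => by simp [hk]
  have hnrpos : ∀ v : EuclideanSpace ℝ (Fin 4), 0 < v 1 ^ 2 + v 2 ^ 2 → 0 < nr v := fun v hv =>
    Real.sqrt_pos.2 hv
  have hnrsq : ∀ v : EuclideanSpace ℝ (Fin 4), nr v ^ 2 = v 1 ^ 2 + v 2 ^ 2 := fun v =>
    Real.sq_sqrt (by positivity)
  -- the key identity `m_s · r = (1 - σ) r + σ ρ`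
  have hmr : ∀ s v, 0 < v 1 ^ 2 + v 2 ^ 2 → m s v * nr v = (1 - σ s) * nr v + σ s * ρ :=
    fun s v hv => by
      simp only [hm]
      field_simp [(hnrpos v hv).ne']
  have hmpos : ∀ s v, 0 < v 1 ^ 2 + v 2 ^ 2 → 0 < m s v := fun s v hv => by
    have h1 : 0 < (1 - σ s) * nr v + σ s * ρ := by
      rcases eq_or_lt_of_le (hσ01 s).2 with h | h
      · rw [h]; simpa using hρ
      · exact add_pos_of_pos_of_nonneg (mul_pos (by linarith) (hnrpos v hv))
          (mul_nonneg (hσ01 s).1 hρ.le)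
    rw [← hmr s v hv] at h1
    exact pos_of_mul_pos_left h1 (hnrpos v hv).le
  refine ⟨k, ?_, fun v => ?_, fun s v hs => ?_, fun s v hs => ?_, fun v hv => ?_, fun s v hv => ?_,
    fun s v hv => ?_, fun s v hv hvδ => ?_, fun s v => ?_⟩
  · -- continuity on `ℝ × {x₁² + x₂² > 0}`
    have hmc : ContinuousOn (fun x : ℝ × EuclideanSpace ℝ (Fin 4) => m x.1 x.2)
        (univ ×ˢ {v | 0 < v 1 ^ 2 + v 2 ^ 2}) := by
      have h1 : Continuous fun x : ℝ × EuclideanSpace ℝ (Fin 4) => nr x.2 := by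
        simp only [hnr]; fun_prop
      refine ((continuous_const.sub (hσc.comp continuous_fst)).continuousOn).add ?_
      refine ((hσc.comp continuous_fst).mul continuous_const).continuousOn.div h1.continuousOn ?_
      rintro ⟨s, v⟩ ⟨-, hv⟩
      exact (hnrpos v hv).ne'
    have hc0 : Continuous fun x : ℝ × EuclideanSpace ℝ (Fin 4) => (1 - σ x.1) * x.2 0 := by fun_prop
    have hc3 : Continuous fun x : ℝ × EuclideanSpace ℝ (Fin 4) => (1 - σ x.1) * x.2 3 := by fun_prop
    have hc1 : ContinuousOn (fun x : ℝ × EuclideanSpace ℝ (Fin 4) => m x.1 x.2 * x.2 1)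
        (univ ×ˢ {v | 0 < v 1 ^ 2 + v 2 ^ 2}) := hmc.mul (by fun_prop : Continuous fun x :
          ℝ × EuclideanSpace ℝ (Fin 4) => x.2 1).continuousOn
    have hc2 : ContinuousOn (fun x : ℝ × EuclideanSpace ℝ (Fin 4) => m x.1 x.2 * x.2 2)
        (univ ×ˢ {v | 0 < v 1 ^ 2 + v 2 ^ 2}) := hmc.mul (by fun_prop : Continuous fun x :
          ℝ × EuclideanSpace ℝ (Fin 4) => x.2 2).continuousOn
    simp only [hk]
    refine (PiLp.continuous_toLp 2 _).comp_continuousOn ?_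
    refine continuousOn_pi.2 fun i => ?_
    fin_cases i
    · simpa using hc0.continuousOn
    · simpa using hc1
    · simpa using hc2
    · simpa using hc3.continuousOn
  · -- `k 0 = id`
    ext i
    have h0 : σ 0 = 0 := hσ0 0 le_rfl
    fin_cases i <;> simp [hk, hm, h0]
  · ext i
    fin_cases i <;> simp [hk, hm, hσ0 s hs]
  · ext i
    fin_cases i <;> simp [hk, hm, hσ1 s hs, hσ1 1 le_rfl]
  · have h1 : σ 1 = 1 := hσ1 1 le_rfl
    refine ⟨by simp [hk0, h1], ?_, ?_, by simp [hk3, h1]⟩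
    · rw [hk1]; simp only [hm, h1, sub_self, one_mul, zero_add]; rw [hnr]; ring
    · rw [hk2]; simp only [hm, h1, sub_self, one_mul, zero_add]; rw [hnr]; ring
  · -- the outside of the cone is preserved
    have hv12 : 0 < v 1 ^ 2 + v 2 ^ 2 := by nlinarith [sq_nonneg (v 3)]
    rw [hk1, hk2, hk3]
    have e : (m s v * v 1) ^ 2 + (m s v * v 2) ^ 2 = (m s v * nr v) ^ 2 := by
      rw [mul_pow, mul_pow, mul_pow, hnrsq]; ring
    rw [e, hmr s v hv12]
    -- `((1-σ) r + σ ρ)² > (1-σ)² x₃²` since `r > |x₃|`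
    have hr3 : v 3 ^ 2 < nr v ^ 2 := by rw [hnrsq]; linarith
    have hr3' : |v 3| < nr v := by
      have := Real.sqrt_lt_sqrt (sq_nonneg _) hr3
      rwa [Real.sqrt_sq_eq_abs, Real.sqrt_sq (hnrpos v hv12).le] at this
    have h1σ : 0 ≤ 1 - σ s := sub_nonneg.2 (hσ01 s).2
    have key : (1 - σ s) * |v 3| < (1 - σ s) * nr v + σ s * ρ := by
      rcases eq_or_lt_of_le (hσ01 s).2 with h | h
      · rw [h]; simp; exact hρ
      · have : (1 - σ s) * |v 3| < (1 - σ s) * nr v := mul_lt_mul_of_pos_left hr3' (by linarith)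
        nlinarith [(hσ01 s).1, hρ.le]
    have hB0 : 0 ≤ (1 - σ s) * |v 3| := mul_nonneg h1σ (abs_nonneg _)
    have hsq : ((1 - σ s) * v 3) ^ 2 = ((1 - σ s) * |v 3|) ^ 2 := by rw [mul_pow, mul_pow, sq_abs]
    rw [hsq]
    nlinarith [mul_pos (sub_pos.2 key) (by linarith : 0 < (1 - σ s) * nr v + σ s * ρ + (1 - σ s) * |v 3|)]
  · rw [hk1, hk2]
    have e : (m s v * v 1) ^ 2 + (m s v * v 2) ^ 2 = m s v ^ 2 * (v 1 ^ 2 + v 2 ^ 2) := by ring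
    rw [e]
    exact mul_pos (pow_pos (hmpos s v hv) 2) hv
  · -- the ball `‖v‖ < δ` is preserved
    have hn2 : ∀ w : EuclideanSpace ℝ (Fin 4), ‖w‖ ^ 2 = w 0 ^ 2 + w 1 ^ 2 + w 2 ^ 2 + w 3 ^ 2 :=
      fun w => by
        rw [EuclideanSpace.norm_eq, Real.sq_sqrt (Finset.sum_nonneg fun i _ => by positivity),
          Fin.sum_univ_four]
        simp [sq_abs]
    have hks : ‖k s v‖ ^ 2 = (1 - σ s) ^ 2 * (v 0 ^ 2 + v 3 ^ 2) + ((1 - σ s) * nr v + σ s * ρ) ^ 2 := by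
      rw [hn2, hk0, hk1, hk2, hk3, ← hmr s v hv, mul_pow (m s v) (nr v), hnrsq]; ring
    have hv2 : ‖v‖ ^ 2 = v 0 ^ 2 + v 3 ^ 2 + nr v ^ 2 := by rw [hn2, hnrsq]; ring
    have hnrle : nr v ≤ ‖v‖ := by
      calc nr v = Real.sqrt (v 1 ^ 2 + v 2 ^ 2) := rfl
        _ ≤ Real.sqrt (‖v‖ ^ 2) :=
            Real.sqrt_le_sqrt (by rw [hn2]; nlinarith [sq_nonneg (v 0), sq_nonneg (v 3)])
        _ = ‖v‖ := Real.sqrt_sq (norm_nonneg v)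
    have h1σ : 0 ≤ 1 - σ s := sub_nonneg.2 (hσ01 s).2
    have hbound : ‖k s v‖ ^ 2 ≤ ((1 - σ s) * ‖v‖ + σ s * ρ) ^ 2 := by
      rw [hks]
      nlinarith [hv2, mul_nonneg (mul_nonneg (mul_nonneg h1σ (hσ01 s).1) hρ.le) (sub_nonneg.2 hnrle)]
    have hlt : (1 - σ s) * ‖v‖ + σ s * ρ < δ := by
      rcases eq_or_lt_of_le (hσ01 s).2 with h | h
      · rw [h]; simpa using hρδ
      · have : (1 - σ s) * ‖v‖ < (1 - σ s) * δ := mul_lt_mul_of_pos_left hvδ (by linarith)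
        nlinarith [(hσ01 s).1, hρδ]
    have hnn : 0 ≤ (1 - σ s) * ‖v‖ + σ s * ρ := by positivity
    have hδ : 0 < δ := hρ.trans hρδ
    have h2 : ‖k s v‖ ^ 2 < δ ^ 2 := hbound.trans_lt (by nlinarith [hlt, hnn])
    exact lt_of_pow_lt_pow_left₀ 2 hδ.le h2
  · rw [hk0, abs_mul, abs_of_nonneg (sub_nonneg.2 (hσ01 s).2)]
    have : (1 - σ s) * |v 0| ≤ 1 * |v 0| :=
      mul_le_mul_of_nonneg_right (by linarith [(hσ01 s).1]) (abs_nonneg _)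
    linarith

end Summit.SmoothPoincare4.SmoothPoincare4.Cruxes.RungOne.Sketch

end
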